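/-
Copyright (c) 2026. All rights reserved.
Released under Apache 2.0 license as described in the file LICENSE.
-/
import Literature.Probability.FitznerVanDerHofstad2017.SrwRegionSplitAxis
import Literature.Probability.FitznerVanDerHofstad2017.SrwIntegralTUCellSup
import HarnessLib

/-!
# REGION-SPLIT, cell side: assembling the external axis-family bound from finitely many axis CELLS
# and an m-uniform tail; the `U` and `T` analogues of the axis-bound sup lemmas

Support module (d-generic, number-free, definition-free), the consumer side of `SrwRegionSplitAxis`.
That module turns a sup over the region `{Σ_μ |x_μ| ≥ m₀}` of a `W_d`-invariant table `F` into
`max (axis family, multi-support cone)`, with the AXIS FAMILY left open as the hypothesis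
`hax : ∀ a ≥ m₀, F (vecOfParts d [a]) ≤ A` (sorted representative `a e₀`).  The KU-SEP chain certifies the
axis family CELL BY CELL — one rational bound per node `m e_i`, `m₀ ≤ |m| < M` (`SrwTrigMajorantClassRows`,
`SrwTrigMajorantKM2EvenRow`, `SrwTrigMajorantAtomClosures`) — plus ONE m-uniform row for `|m| ≥ M`
(`SrwTrigMajorantEncl.srwK_zero_single_le_uniform_gset_cast` and its kin), all stated at `Pi.single i m` for an
arbitrary axis `i`.  This file supplies, once for general `d`, the bookkeeping between the two shapes:

* `apply_single_eq_of_spInvariant`, `apply_single_neg_eq_of_spInvariant` — for a `W_d`-invariant `F`,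
  `F (m e_i)` depends neither on the axis `i` nor on the sign of `m` (the `Pi.single` forms of
  `SrwIntegralIShiftCellSup.axisVec_eq_of_spInvariant` / `axisVec_neg_eq_of_spInvariant`);
* `axisFamily_of_cell_of_succ` — PEEL ONE CELL: `F (m₀ e_i) ≤ A` and `F (m e_i) ≤ A` for `|m| ≥ m₀ + 1` give
  `F (m e_i) ≤ A` for `|m| ≥ m₀` (so a kernel instance nests `k` cells onto the uniform tail by `k` applications);
* `axisBound_of_axisFamily` — the family `∀ m : ℤ, m₀ ≤ |m| → F (m e_i) ≤ A` at ANY axis `i` IS the hypothesis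
  `hax` of `SrwRegionSplitAxis.le_of_axis_or_multi` / `srwK_le_of_axisBound_nodeSplits_two/three`;
* `srwK_le_of_axisFamily_nodeSplits_two/three` — the `K` sup lemmas of `SrwRegionSplitAxis` §3 restated with the
  `Pi.single` axis family;
* `srwU_le_of_axisBound_nodeBounds_one/two/three` (+ the `Pi.single` forms `srwU_le_of_axisFamily_nodeBounds_…`) —
  the `U` ANALOGUE of `SrwRegionSplitAxis` §3: external axis-family bound `A` on the axis branch, and on the
  multi-support cone the landed route (5.9) `U ≤ √V_{n,2l} · √L_n` with the sorted-antitone `L_n` read at the nodes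
  `1^r` (and the pair `2e₁+e₂`, `2e₁+2e₂` for `m₀ = 3`) — conclusion `U_{n,l}(x) ≤ max A (√V' · √B)` on the region;
* `srwK_le_of_axisBound_nodeSplits_one` / `srwK_le_of_axisFamily_nodeSplits_one` — the `x ≠ 0` region for `K`
  (`m₀ = 1`; the cone is `{suppCount ≥ 2}` and is discharged by the `1^r` splits, `r ≥ 2`);
* `apply_single_eq_apply_vecOfParts_natAbs` (`F (m e_i) = F (|m| e₀)`) and the Cauchy–Schwarz TAILS
  `srwK_axisFamily_of_split` (`√I_{n,2m}(0)·√W_{n,j}(M e₀) ≤ C ⇒ K_{n,m+j}(m' e_i) ≤ C`, `|m'| ≥ M`) and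
  `srwU_axisFamily_of_split` (`V_{n,2l} ≤ V'`, `L_n(M e₀) ≤ B ⇒ U_{n,l}(m e_i) ≤ √V'·√B`, `|m| ≥ M`) — the far
  cells of an axis family by sorted antitonicity along the axis, when they are not certified individually;
* `srwT_le_of_axisBound_nodeSplits_{two,three}_{four,two}` (+ cell-shape forms
  `srwT_le_of_axisFamily_nodeSplits_{two,three}_{four,two}`) — the `T` analogue: external axis family, and on the
  cone (5.11) `T ≤ K_{n,l+1} + (4/d) K_{n,l}` (rule `4/d`) or `T ≤ K_{n,l+1} + (2/d) K_{n+1,l}` (rule `2/d`) through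
  two `K` splits per node (`SrwIntegralTUCellSup.srwT_le_of_srwK_le_four/two`); conclusion
  `T_{n,l}(x) ≤ max A (C₁ + (4/d) C₀)` resp. `max A (C₁ + (2/d) C₀)`;
* §7 `exists_split_of_seedBounds_cast`, `forall_split_of_seedBounds_cast`, `exists_pairSplit_of_seedBounds_cast`,
  `srwK_axisFamily_of_seedBounds_cast`, `srwU_axisFamily_of_seedBounds_cast`, `srwT_axisFamily_of_seedBounds_cast_four/two`,
  `srwU_le_of_axisFamily_nodeBounds_one/two/three_cast` — every real square-root slot (cone splits, tails, the `U`
  conclusion `√V'·√B`) discharged from ℚ upper bounds of the plain seeds with ℚ side conditions `0 ≤ C`, `iU·wU ≤ C²`.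

All statements are monotone bookkeeping for general `d`; no axis-family bound and no node value is proved here,
nothing is numerical and nothing is a certificate.  No dimension-specific declaration is introduced.

References: [NoBLE17-I] R. Fitzner, R. van der Hofstad, *Generalized approach to the non-backtracking lace
expansion*, Probab. Theory Relat. Fields 169 (2017) 1041–1119 (arXiv:1506.07969; bib key
`FitznerVanDerHofstad2016NoBLE`): (3.35)–(3.38) p. 1071 (the tables and their `W_d`-invariance), §5.1 p. 1093
("by Lemma 5.1 it suffices to consider the minimal elements …"), §5.2 (5.9), (5.11), (5.12), (5.15)–(5.16) pp. 1091–1092;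
[HS92b] T. Hara, G. Slade, *The lace expansion for self-avoiding walk in five or more dimensions*, Rev. Math.
Phys. 4 (1992) 235–327, App. B, Lemma B.4 (sorted monotonicity; bib key `HaraSlade1992b`); applied in [FvdH17]
R. Fitzner, R. van der Hofstad, *Mean-field behavior for nearest-neighbor percolation in `d > 10`*, Electron. J.
Probab. 22 (2017) no. 43.
-/

namespace Literature.Probability.FitznerVanDerHofstad2017

open Finset
open scoped BigOperators

variable {d : ℕ}

/-! ### §1  `F (m e_i)` is independent of the axis and of the sign -/

/-- `axisVec i a = Pi.single i a`. [folklore] -/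
private theorem axisVec_eq_piSingle (i : Fin d) (a : ℤ) : axisVec i a = Pi.single i a := by
  funext μ
  by_cases h : μ = i
  · subst h
    simp [axisVec]
  · simp [axisVec, h]

/-- For a `W_d`-invariant table, `F (a e_i) = F (a e_{i'})`: the value at an axis node does not depend on the axis.
[cite: FitznerVanDerHofstad2016NoBLE, (3.35) p. 1071, §5.1 p. 1093] -/
theorem apply_single_eq_of_spInvariant {F : (Fin d → ℤ) → ℝ} (hI : SpInvariant F) (i i' : Fin d) (a : ℤ) :
    F (Pi.single i a) = F (Pi.single i' a) := by
  have h := hI (Equiv.swap i i', fun _ => (1 : ℤˣ)) (Pi.single i a)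
  rw [← axisVec_eq_piSingle, spAct_swap_axisVec, Units.val_one, one_mul, axisVec_eq_piSingle,
    axisVec_eq_piSingle] at h
  exact h.symm

/-- For a `W_d`-invariant table, `F (−a e_i) = F (a e_i)`.
[cite: FitznerVanDerHofstad2016NoBLE, (3.35) p. 1071, §5.1 p. 1093] -/
theorem apply_single_neg_eq_of_spInvariant {F : (Fin d → ℤ) → ℝ} (hI : SpInvariant F) (i : Fin d) (a : ℤ) :
    F (Pi.single i (-a)) = F (Pi.single i a) := by
  have h := hI (Equiv.swap i i, fun _ => (-1 : ℤˣ)) (Pi.single i a)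
  rw [← axisVec_eq_piSingle, spAct_swap_axisVec, Units.val_neg, Units.val_one, neg_one_mul,
    axisVec_eq_piSingle, axisVec_eq_piSingle] at h
  exact h

/-- For a `W_d`-invariant table, `F (m e_i) = F (|m| e₀)`: the value at any axis node is the value at the SORTED
representative `vecOfParts d [|m|]` of `SrwIntegralSortedMonotone`.
[cite: FitznerVanDerHofstad2016NoBLE, (3.35) p. 1071, §5.1 p. 1093] -/
theorem apply_single_eq_apply_vecOfParts_natAbs {F : (Fin d → ℤ) → ℝ} (hI : SpInvariant F) (hd : 1 ≤ d)
    (i : Fin d) (m : ℤ) : F (Pi.single i m) = F (vecOfParts d [m.natAbs]) := by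
  rw [vecOfParts_single_eq_single hd, apply_single_eq_of_spInvariant hI ⟨0, hd⟩ i]
  rcases Int.natAbs_eq m with h | h
  · exact congrArg (fun t => F (Pi.single i t)) h
  · rw [← apply_single_neg_eq_of_spInvariant hI i (m.natAbs : ℤ)]
    exact congrArg (fun t => F (Pi.single i t)) h

/-! ### §2  Peeling cells and the bridge to the `vecOfParts d [a]` hypothesis -/

/-- **Peel one cell.**  For a `W_d`-invariant `F`: the cell bound `F (m₀ e_i) ≤ A` and the tail
`F (m e_i) ≤ A` for all `|m| ≥ m₀ + 1` give `F (m e_i) ≤ A` for all `|m| ≥ m₀` (the node `−m₀ e_i` by sign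
symmetry). [cite: FitznerVanDerHofstad2016NoBLE, (3.35) p. 1071, §5.1 p. 1093] -/
theorem axisFamily_of_cell_of_succ {F : (Fin d → ℤ) → ℝ} (hI : SpInvariant F) (i : Fin d) {m₀ : ℕ} {A : ℝ}
    (h0 : F (Pi.single i (m₀ : ℤ)) ≤ A)
    (htail : ∀ m : ℤ, m₀ + 1 ≤ m.natAbs → F (Pi.single i m) ≤ A) :
    ∀ m : ℤ, m₀ ≤ m.natAbs → F (Pi.single i m) ≤ A := by
  intro m hm
  rcases Nat.eq_or_lt_of_le hm with h | h
  · rcases Int.natAbs_eq m with h' | h'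
    · rw [h', ← h]
      exact h0
    · rw [h', ← h, apply_single_neg_eq_of_spInvariant hI]
      exact h0
  · exact htail m h

/-- **Peel one cell, with a slack step** (`F (m₀ e_i) ≤ q`, `q ≤ A`): the form a kernel instance uses when the
cells carry their own rational values `q` below the common ceiling `A`.
[cite: FitznerVanDerHofstad2016NoBLE, (3.35) p. 1071, §5.1 p. 1093] -/
theorem axisFamily_of_cell_le_of_succ {F : (Fin d → ℤ) → ℝ} (hI : SpInvariant F) (i : Fin d) {m₀ : ℕ}
    {q A : ℝ} (h0 : F (Pi.single i (m₀ : ℤ)) ≤ q) (hq : q ≤ A)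
    (htail : ∀ m : ℤ, m₀ + 1 ≤ m.natAbs → F (Pi.single i m) ≤ A) :
    ∀ m : ℤ, m₀ ≤ m.natAbs → F (Pi.single i m) ≤ A :=
  axisFamily_of_cell_of_succ hI i (h0.trans hq) htail

/-- **An m-uniform tail with a slack step**: `F (m e_i) ≤ q` for `|m| ≥ M` and `q ≤ A`.  [folklore] bookkeeping for
[cite: FitznerVanDerHofstad2016NoBLE, §5.1 p. 1093] -/
theorem axisFamily_of_uniform_le {F : (Fin d → ℤ) → ℝ} (i : Fin d) {M : ℕ} {q A : ℝ}
    (hu : ∀ m : ℤ, M ≤ m.natAbs → F (Pi.single i m) ≤ q) (hq : q ≤ A) :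
    ∀ m : ℤ, M ≤ m.natAbs → F (Pi.single i m) ≤ A := fun m hm => (hu m hm).trans hq

/-- **The bridge.**  For a `W_d`-invariant `F`, the axis family at ANY axis `i`,
`∀ m : ℤ, m₀ ≤ |m| → F (m e_i) ≤ A`, is the external axis-family hypothesis
`∀ a ≥ m₀, F (vecOfParts d [a]) ≤ A` of `SrwRegionSplitAxis.le_of_axis_or_multi`.
[cite: FitznerVanDerHofstad2016NoBLE, (3.35) p. 1071, §5.1 p. 1093] -/
theorem axisBound_of_axisFamily {F : (Fin d → ℤ) → ℝ} (hI : SpInvariant F) (hd : 1 ≤ d) (i : Fin d)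
    {m₀ : ℕ} {A : ℝ} (h : ∀ m : ℤ, m₀ ≤ m.natAbs → F (Pi.single i m) ≤ A) :
    ∀ a : ℕ, m₀ ≤ a → F (vecOfParts d [a]) ≤ A := by
  intro a ha
  rw [vecOfParts_single_eq_single hd, apply_single_eq_of_spInvariant hI ⟨0, hd⟩ i]
  exact h a (by simpa using ha)

/-- `x ≠ 0` gives `1 ≤ Σ_μ |x_μ|`. [folklore] -/
private theorem one_le_sum_abs_of_ne_zero {x : Fin d → ℤ} (hx : x ≠ 0) : (1 : ℤ) ≤ ∑ j, |x j| := by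
  obtain ⟨μ, hμ⟩ := Function.ne_iff.mp hx
  have h1 : (1 : ℤ) ≤ |x μ| := Int.one_le_abs hμ
  exact h1.trans (Finset.single_le_sum (fun j _ => abs_nonneg (x j)) (Finset.mem_univ μ))

/-! ### §3  `K`: the sup lemmas with the `Pi.single` axis family (and the region `x ≠ 0`) -/

/-- **`sup_{x ≠ 0} K_{n,l}` with an external axis-family bound** (`n ≥ 1`, `d ≥ 2n+1`): if `K_{n,l}(a e₀) ≤ A`
for every `a ≥ 1` and the nodes `1^r` (`2 ≤ r ≤ d`) carry Cauchy–Schwarz splits `√I_{n,2m}(0) √W_{n,j}(1^r) ≤ C`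
(`m + j = l`), then `K_{n,l}(x) ≤ max A C` for every `x ≠ 0`.
[cite: FitznerVanDerHofstad2016NoBLE, (5.15)–(5.16) p. 1092 and §5.1 p. 1093] -/
theorem srwK_le_of_axisBound_nodeSplits_one {n : ℕ} (hn : 1 ≤ n) (hd : 2 * n + 1 ≤ d) (l : ℕ) (A C : ℝ)
    (hax : ∀ a : ℕ, 1 ≤ a → srwK d n l (vecOfParts d [a]) ≤ A)
    (hC : ∀ r : ℕ, 2 ≤ r → r ≤ d → ∃ m j, m + j = l ∧
      Real.sqrt (srwI d n (2 * m) 0) * Real.sqrt (srwW d n j (classVec d r 0)) ≤ C)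
    (x : Fin d → ℤ) (hx : x ≠ 0) : srwK d n l x ≤ max A C := by
  refine le_max_of_axis_or_multi (srwK d n l) (fun τ x => srwK_spAct n l τ x) A C (m₀ := 1) le_rfl
    hax (fun y hy hy0 h2 _ => ?_) x (by exact_mod_cast one_le_sum_abs_of_ne_zero hx)
  obtain ⟨m, j, rfl, hle⟩ := hC _ h2 (suppCount_le _)
  exact (srwK_le_sqrt_of_srwW_le hd m j y
    (le_classVec_suppCount_of_antitone _ (sortedAntitone_srwW hn hd j) y hy hy0)).trans hle

/-- **`sup_{x ≠ 0} K_{n,l}`, axis family in cell shape** (`Pi.single i m`, `|m| ≥ 1`, any axis `i`).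
[cite: FitznerVanDerHofstad2016NoBLE, (5.15)–(5.16) p. 1092 and §5.1 p. 1093] -/
theorem srwK_le_of_axisFamily_nodeSplits_one {n : ℕ} (hn : 1 ≤ n) (hd : 2 * n + 1 ≤ d) (l : ℕ) (A C : ℝ)
    (i : Fin d) (hax : ∀ m : ℤ, 1 ≤ m.natAbs → srwK d n l (Pi.single i m) ≤ A)
    (hC : ∀ r : ℕ, 2 ≤ r → r ≤ d → ∃ m j, m + j = l ∧
      Real.sqrt (srwI d n (2 * m) 0) * Real.sqrt (srwW d n j (classVec d r 0)) ≤ C)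
    (x : Fin d → ℤ) (hx : x ≠ 0) : srwK d n l x ≤ max A C :=
  srwK_le_of_axisBound_nodeSplits_one hn hd l A C
    (axisBound_of_axisFamily (fun τ x => srwK_spAct n l τ x) (by omega) i hax) hC x hx

/-- **`sup_{‖x‖₁ ≥ 2} K_{n,l}`, axis family in cell shape** (`Pi.single i m`, `|m| ≥ 2`, any axis `i`):
`SrwRegionSplitAxis.srwK_le_of_axisBound_nodeSplits_two` with the bridge.
[cite: FitznerVanDerHofstad2016NoBLE, (5.15)–(5.16) p. 1092 and §5.1 p. 1093] -/
theorem srwK_le_of_axisFamily_nodeSplits_two {n : ℕ} (hn : 1 ≤ n) (hd : 2 * n + 1 ≤ d) (l : ℕ) (A C : ℝ)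
    (i : Fin d) (hax : ∀ m : ℤ, 2 ≤ m.natAbs → srwK d n l (Pi.single i m) ≤ A)
    (hC : ∀ r : ℕ, 2 ≤ r → r ≤ d → ∃ m j, m + j = l ∧
      Real.sqrt (srwI d n (2 * m) 0) * Real.sqrt (srwW d n j (classVec d r 0)) ≤ C)
    (x : Fin d → ℤ) (hx : 2 ≤ ∑ j, |x j|) : srwK d n l x ≤ max A C :=
  srwK_le_of_axisBound_nodeSplits_two hn hd l A C
    (axisBound_of_axisFamily (fun τ x => srwK_spAct n l τ x) (by omega) i hax) hC x hx

/-- **`sup_{‖x‖₁ ≥ 3} K_{n,l}`, axis family in cell shape** (`Pi.single i m`, `|m| ≥ 3`, any axis `i`):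
`SrwRegionSplitAxis.srwK_le_of_axisBound_nodeSplits_three` with the bridge.
[cite: FitznerVanDerHofstad2016NoBLE, (5.15)–(5.16) p. 1092 and §5.1 p. 1093] -/
theorem srwK_le_of_axisFamily_nodeSplits_three {n : ℕ} (hn : 1 ≤ n) (hd : 2 * n + 1 ≤ d) (l : ℕ) (A C : ℝ)
    (i : Fin d) (hax : ∀ m : ℤ, 3 ≤ m.natAbs → srwK d n l (Pi.single i m) ≤ A)
    (h2x : ∃ m j, m + j = l ∧
      Real.sqrt (srwI d n (2 * m) 0) * Real.sqrt (srwW d n j (vecOfParts d [2, 1])) ≤ C ∧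
      Real.sqrt (srwI d n (2 * m) 0) * Real.sqrt (srwW d n j (vecOfParts d [2, 2])) ≤ C)
    (hC : ∀ r : ℕ, 3 ≤ r → r ≤ d → ∃ m j, m + j = l ∧
      Real.sqrt (srwI d n (2 * m) 0) * Real.sqrt (srwW d n j (classVec d r 0)) ≤ C)
    (x : Fin d → ℤ) (hx : 3 ≤ ∑ j, |x j|) : srwK d n l x ≤ max A C :=
  srwK_le_of_axisBound_nodeSplits_three hn hd l A C
    (axisBound_of_axisFamily (fun τ x => srwK_spAct n l τ x) (by omega) i hax) h2x hC x hx

/-! ### §4  `U`: external axis-family bound + (5.9) on the multi-support cone -/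

/-- **`sup_{x ≠ 0} U_{n,l}` with an external axis-family bound** (`n ≥ 1`, `d ≥ 2n+1`): if `U_{n,l}(a e₀) ≤ A`
for every `a ≥ 1`, `V_{n,2l} ≤ V'` and `L_n(1^r) ≤ B` (`2 ≤ r ≤ d`), then `U_{n,l}(x) ≤ max A (√V' · √B)` for every
`x ≠ 0` (on the multi-support cone: (5.9) `U ≤ √V √L` and the sorted antitonicity of `L_n`).
[cite: FitznerVanDerHofstad2016NoBLE, (5.9) p. 1091, §5.1 p. 1093; HaraSlade1992b, App. B, Lemma B.4] -/
theorem srwU_le_of_axisBound_nodeBounds_one {n : ℕ} (hn : 1 ≤ n) (hd : 2 * n + 1 ≤ d) (l : ℕ) (A : ℝ)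
    {V' B : ℝ} (hax : ∀ a : ℕ, 1 ≤ a → srwU d n l (vecOfParts d [a]) ≤ A)
    (hV : srwV d n (2 * l) ≤ V') (hB : ∀ r : ℕ, 2 ≤ r → r ≤ d → srwL d n (classVec d r 0) ≤ B)
    (x : Fin d → ℤ) (hx : x ≠ 0) : srwU d n l x ≤ max A (Real.sqrt V' * Real.sqrt B) := by
  have hI : SpInvariant (srwU d n l) := fun τ y => by
    unfold srwU
    simp_rw [DhatSym_spAct]
  exact le_max_of_axis_or_multi (srwU d n l) hI A _ (m₀ := 1) le_rfl hax
    (fun y hy hy0 h2 _ => srwU_le_sqrt_of_le hd l y hV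
      (le_of_multiNodeBounds_two (srwL d n) (sortedAntitone_srwL hn hd) B hB y hy hy0 h2))
    x (by exact_mod_cast one_le_sum_abs_of_ne_zero hx)

/-- **`sup_{‖x‖₁ ≥ 2} U_{n,l}` with an external axis-family bound** (`n ≥ 1`, `d ≥ 2n+1`): axis family `≤ A`
(`a ≥ 2`), `V_{n,2l} ≤ V'`, `L_n(1^r) ≤ B` (`2 ≤ r ≤ d`) ⇒ `U_{n,l}(x) ≤ max A (√V' · √B)` whenever `Σ_μ |x_μ| ≥ 2`.
[cite: FitznerVanDerHofstad2016NoBLE, (5.9) p. 1091, §5.1 p. 1093, §5.2 p. 1096; HaraSlade1992b, App. B, Lemma B.4] -/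
theorem srwU_le_of_axisBound_nodeBounds_two {n : ℕ} (hn : 1 ≤ n) (hd : 2 * n + 1 ≤ d) (l : ℕ) (A : ℝ)
    {V' B : ℝ} (hax : ∀ a : ℕ, 2 ≤ a → srwU d n l (vecOfParts d [a]) ≤ A)
    (hV : srwV d n (2 * l) ≤ V') (hB : ∀ r : ℕ, 2 ≤ r → r ≤ d → srwL d n (classVec d r 0) ≤ B)
    (x : Fin d → ℤ) (hx : 2 ≤ ∑ j, |x j|) : srwU d n l x ≤ max A (Real.sqrt V' * Real.sqrt B) := by
  have hI : SpInvariant (srwU d n l) := fun τ y => by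
    unfold srwU
    simp_rw [DhatSym_spAct]
  exact le_max_of_axis_or_multi (srwU d n l) hI A _ (m₀ := 2) (by norm_num) hax
    (fun y hy hy0 h2 _ => srwU_le_sqrt_of_le hd l y hV
      (le_of_multiNodeBounds_two (srwL d n) (sortedAntitone_srwL hn hd) B hB y hy hy0 h2))
    x (by exact_mod_cast hx)

/-- **`sup_{‖x‖₁ ≥ 3} U_{n,l}` with an external axis-family bound** (`n ≥ 1`, `d ≥ 2n+1`): axis family `≤ A`
(`a ≥ 3`), `V_{n,2l} ≤ V'`, `L_n(2e₁+e₂) ≤ B`, `L_n(2e₁+2e₂) ≤ B`, `L_n(1^r) ≤ B` (`3 ≤ r ≤ d`) ⇒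
`U_{n,l}(x) ≤ max A (√V' · √B)` whenever `Σ_μ |x_μ| ≥ 3`.
[cite: FitznerVanDerHofstad2016NoBLE, (5.9) p. 1091, §5.1 p. 1093; HaraSlade1992b, App. B, Lemma B.4] -/
theorem srwU_le_of_axisBound_nodeBounds_three {n : ℕ} (hn : 1 ≤ n) (hd : 2 * n + 1 ≤ d) (l : ℕ) (A : ℝ)
    {V' B : ℝ} (hax : ∀ a : ℕ, 3 ≤ a → srwU d n l (vecOfParts d [a]) ≤ A)
    (hV : srwV d n (2 * l) ≤ V') (h21 : srwL d n (vecOfParts d [2, 1]) ≤ B)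
    (h22 : srwL d n (vecOfParts d [2, 2]) ≤ B)
    (hB : ∀ r : ℕ, 3 ≤ r → r ≤ d → srwL d n (classVec d r 0) ≤ B)
    (x : Fin d → ℤ) (hx : 3 ≤ ∑ j, |x j|) : srwU d n l x ≤ max A (Real.sqrt V' * Real.sqrt B) := by
  have hI : SpInvariant (srwU d n l) := fun τ y => by
    unfold srwU
    simp_rw [DhatSym_spAct]
  exact le_max_of_axis_or_multi (srwU d n l) hI A _ (m₀ := 3) (by norm_num) hax
    (fun y hy hy0 h2 h3 => srwU_le_sqrt_of_le hd l y hV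
      (le_of_multiNodeBounds_three (srwL d n) (sortedAntitone_srwL hn hd) B h21 h22 hB y hy hy0 h2
        (by exact_mod_cast h3)))
    x (by exact_mod_cast hx)

/-- **`sup_{x ≠ 0} U_{n,l}`, axis family in cell shape** (`Pi.single i m`, `|m| ≥ 1`, any axis `i`).
[cite: FitznerVanDerHofstad2016NoBLE, (5.9) p. 1091, §5.1 p. 1093] -/
theorem srwU_le_of_axisFamily_nodeBounds_one {n : ℕ} (hn : 1 ≤ n) (hd : 2 * n + 1 ≤ d) (l : ℕ) (A : ℝ)
    {V' B : ℝ} (i : Fin d) (hax : ∀ m : ℤ, 1 ≤ m.natAbs → srwU d n l (Pi.single i m) ≤ A)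
    (hV : srwV d n (2 * l) ≤ V') (hB : ∀ r : ℕ, 2 ≤ r → r ≤ d → srwL d n (classVec d r 0) ≤ B)
    (x : Fin d → ℤ) (hx : x ≠ 0) : srwU d n l x ≤ max A (Real.sqrt V' * Real.sqrt B) :=
  srwU_le_of_axisBound_nodeBounds_one hn hd l A
    (axisBound_of_axisFamily (fun τ y => by unfold srwU; simp_rw [DhatSym_spAct]) (by omega) i hax)
    hV hB x hx

/-- **`sup_{‖x‖₁ ≥ 2} U_{n,l}`, axis family in cell shape** (`Pi.single i m`, `|m| ≥ 2`, any axis `i`).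
[cite: FitznerVanDerHofstad2016NoBLE, (5.9) p. 1091, §5.1 p. 1093, §5.2 p. 1096] -/
theorem srwU_le_of_axisFamily_nodeBounds_two {n : ℕ} (hn : 1 ≤ n) (hd : 2 * n + 1 ≤ d) (l : ℕ) (A : ℝ)
    {V' B : ℝ} (i : Fin d) (hax : ∀ m : ℤ, 2 ≤ m.natAbs → srwU d n l (Pi.single i m) ≤ A)
    (hV : srwV d n (2 * l) ≤ V') (hB : ∀ r : ℕ, 2 ≤ r → r ≤ d → srwL d n (classVec d r 0) ≤ B)
    (x : Fin d → ℤ) (hx : 2 ≤ ∑ j, |x j|) : srwU d n l x ≤ max A (Real.sqrt V' * Real.sqrt B) :=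
  srwU_le_of_axisBound_nodeBounds_two hn hd l A
    (axisBound_of_axisFamily (fun τ y => by unfold srwU; simp_rw [DhatSym_spAct]) (by omega) i hax)
    hV hB x hx

/-- **`sup_{‖x‖₁ ≥ 3} U_{n,l}`, axis family in cell shape** (`Pi.single i m`, `|m| ≥ 3`, any axis `i`).
[cite: FitznerVanDerHofstad2016NoBLE, (5.9) p. 1091, §5.1 p. 1093] -/
theorem srwU_le_of_axisFamily_nodeBounds_three {n : ℕ} (hn : 1 ≤ n) (hd : 2 * n + 1 ≤ d) (l : ℕ) (A : ℝ)
    {V' B : ℝ} (i : Fin d) (hax : ∀ m : ℤ, 3 ≤ m.natAbs → srwU d n l (Pi.single i m) ≤ A)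
    (hV : srwV d n (2 * l) ≤ V') (h21 : srwL d n (vecOfParts d [2, 1]) ≤ B)
    (h22 : srwL d n (vecOfParts d [2, 2]) ≤ B)
    (hB : ∀ r : ℕ, 3 ≤ r → r ≤ d → srwL d n (classVec d r 0) ≤ B)
    (x : Fin d → ℤ) (hx : 3 ≤ ∑ j, |x j|) : srwU d n l x ≤ max A (Real.sqrt V' * Real.sqrt B) :=
  srwU_le_of_axisBound_nodeBounds_three hn hd l A
    (axisBound_of_axisFamily (fun τ y => by unfold srwU; simp_rw [DhatSym_spAct]) (by omega) i hax)
    hV h21 h22 hB x hx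

/-! ### §5  The Cauchy–Schwarz TAIL of an axis family (sorted antitonicity along the axis) -/

/-- **`K` axis tail by one Cauchy–Schwarz split at the node `M e₀`** (`n ≥ 1`, `d ≥ 2n+1`): from
`√I_{n,2m}(0) · √W_{n,j}(M e₀) ≤ C` conclude `K_{n,m+j}(m' e_i) ≤ C` for EVERY `|m'| ≥ M` and every axis `i`
(`W_{n,j}` is sorted-antitone along the axis, [HS92b] Lemma B.4) — the `htail` input of `axisFamily_of_cell_of_succ`
when the far cells are not certified individually.
[cite: FitznerVanDerHofstad2016NoBLE, (5.15)–(5.16) p. 1092, §5.1 p. 1093; HaraSlade1992b, App. B, Lemma B.4] -/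
theorem srwK_axisFamily_of_split {n : ℕ} (hn : 1 ≤ n) (hd : 2 * n + 1 ≤ d) (i : Fin d) (M : ℕ) {m j : ℕ}
    {C : ℝ} (hC : Real.sqrt (srwI d n (2 * m) 0) * Real.sqrt (srwW d n j (vecOfParts d [M])) ≤ C) :
    ∀ m' : ℤ, M ≤ m'.natAbs → srwK d n (m + j) (Pi.single i m') ≤ C := fun m' hm' => by
  rw [apply_single_eq_apply_vecOfParts_natAbs (fun τ y => srwK_spAct n (m + j) τ y) (by omega) i m']
  exact (srwK_le_sqrt_of_srwW_le hd m j _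
    (le_vecOfParts_single_of_le _ (sortedAntitone_srwW hn hd j) M _ hm')).trans hC

/-- **`U` axis tail by (5.9) at the node `M e₀`** (`n ≥ 1`, `d ≥ 2n+1`): from `V_{n,2l} ≤ V'` and
`L_n(M e₀) ≤ B` conclude `U_{n,l}(m e_i) ≤ √V' · √B` for every `|m| ≥ M` and every axis `i` (`L_n` is
sorted-antitone along the axis).
[cite: FitznerVanDerHofstad2016NoBLE, (5.9) p. 1091, §5.1 p. 1093; HaraSlade1992b, App. B, Lemma B.4] -/
theorem srwU_axisFamily_of_split {n : ℕ} (hn : 1 ≤ n) (hd : 2 * n + 1 ≤ d) (l : ℕ) (i : Fin d) (M : ℕ)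
    {V' B : ℝ} (hV : srwV d n (2 * l) ≤ V') (hL : srwL d n (vecOfParts d [M]) ≤ B) :
    ∀ m : ℤ, M ≤ m.natAbs → srwU d n l (Pi.single i m) ≤ Real.sqrt V' * Real.sqrt B := fun m hm => by
  have hI : SpInvariant (srwU d n l) := fun τ y => by
    unfold srwU
    simp_rw [DhatSym_spAct]
  rw [apply_single_eq_apply_vecOfParts_natAbs hI (by omega) i m]
  exact srwU_le_sqrt_of_le hd l _ hV
    ((le_vecOfParts_single_of_le _ (sortedAntitone_srwL hn hd) M _ hm).trans hL)

/-! ### §6  `T`: external axis-family bound + (5.11) on the cone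

On the multi-support cone `T_{n,l} ≤ K_{n,l+1} + (4/d) K_{n,l}` (rule `4/d`) or `T_{n,l} ≤ K_{n,l+1} + (2/d) K_{n+1,l}`
(rule `2/d`, `d ≥ 2(n+1)+1`), each `K` bounded by its Cauchy–Schwarz split at the sorted class node — exactly the cone
argument of `SrwRegionSplitAxis.srwK_le_of_axisBound_nodeSplits_two/three`, isolated in the two private lemmas below. -/

/-- [folklore] The cone step of `srwK_le_of_axisBound_nodeSplits_two`: a sorted nonnegative `y` with `suppCount y ≥ 2`
is dominated by the class node `1^{suppCount y}`; the split there bounds `K_{n,l}(y)`. -/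
private theorem srwK_le_of_splits_on_cone_two {n : ℕ} (hn : 1 ≤ n) (hd : 2 * n + 1 ≤ d) {l : ℕ} {C : ℝ}
    (hC : ∀ r : ℕ, 2 ≤ r → r ≤ d → ∃ m j, m + j = l ∧
      Real.sqrt (srwI d n (2 * m) 0) * Real.sqrt (srwW d n j (classVec d r 0)) ≤ C)
    (y : Fin d → ℤ) (hy : Antitone y) (hy0 : ∀ i, 0 ≤ y i) (h2 : 2 ≤ suppCount y) : srwK d n l y ≤ C := by
  obtain ⟨m, j, rfl, hle⟩ := hC _ h2 (suppCount_le _)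
  exact (srwK_le_sqrt_of_srwW_le hd m j y
    (le_classVec_suppCount_of_antitone _ (sortedAntitone_srwW hn hd j) y hy hy0)).trans hle

/-- [folklore] The cone step of `srwK_le_of_axisBound_nodeSplits_three` (`Σ y ≥ 3`: the pair `2e₁+e₂`, `2e₁+2e₂`
when `suppCount y = 2`, the class node `1^r` when `suppCount y = r ≥ 3`). -/
private theorem srwK_le_of_splits_on_cone_three {n : ℕ} (hn : 1 ≤ n) (hd : 2 * n + 1 ≤ d) {l : ℕ} {C : ℝ}
    (h2x : ∃ m j, m + j = l ∧
      Real.sqrt (srwI d n (2 * m) 0) * Real.sqrt (srwW d n j (vecOfParts d [2, 1])) ≤ C ∧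
      Real.sqrt (srwI d n (2 * m) 0) * Real.sqrt (srwW d n j (vecOfParts d [2, 2])) ≤ C)
    (hC : ∀ r : ℕ, 3 ≤ r → r ≤ d → ∃ m j, m + j = l ∧
      Real.sqrt (srwI d n (2 * m) 0) * Real.sqrt (srwW d n j (classVec d r 0)) ≤ C)
    (y : Fin d → ℤ) (hy : Antitone y) (hy0 : ∀ i, 0 ≤ y i) (h2 : 2 ≤ suppCount y) (h3 : 3 ≤ ∑ j, y j) :
    srwK d n l y ≤ C := by
  rcases Nat.lt_or_ge 2 (suppCount y) with hr3 | hr2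
  · obtain ⟨m, j, rfl, hle⟩ := hC _ hr3 (suppCount_le _)
    exact (srwK_le_sqrt_of_srwW_le hd m j y
      (le_classVec_suppCount_of_antitone _ (sortedAntitone_srwW hn hd j) y hy hy0)).trans hle
  · have h2' : suppCount y = 2 := le_antisymm hr2 h2
    obtain ⟨m, j, rfl, hle1, hle2⟩ := h2x
    have hW := le_pair_nodes_of_suppCount_eq_two _ (sortedAntitone_srwW hn hd j) y hy hy0 h2' h3
    rcases le_total (srwW d n j (vecOfParts d [2, 1])) (srwW d n j (vecOfParts d [2, 2])) with h | h
    · rw [max_eq_right h] at hW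
      exact (srwK_le_sqrt_of_srwW_le hd m j y hW).trans hle2
    · rw [max_eq_left h] at hW
      exact (srwK_le_sqrt_of_srwW_le hd m j y hW).trans hle1

/-- **`sup_{‖x‖₁ ≥ 2} T_{n,l}` with an external axis-family bound, rule `4/d`** (`n ≥ 1`, `d ≥ 2n+1`): if
`T_{n,l}(a e₀) ≤ A` for every `a ≥ 2` and the nodes `1^r` (`2 ≤ r ≤ d`) carry Cauchy–Schwarz splits
`√I_{n,2m}(0) √W_{n,j}(1^r) ≤ C₁` (`m + j = l + 1`) and `≤ C₀` (`m + j = l`), then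
`T_{n,l}(x) ≤ max A (C₁ + (4/d) C₀)` whenever `Σ_μ |x_μ| ≥ 2` (on the cone: (5.11) through the two `K` splits).
[cite: FitznerVanDerHofstad2016NoBLE, (5.11) p. 1092, (5.15)–(5.16) p. 1092, §5.1 p. 1093] -/
theorem srwT_le_of_axisBound_nodeSplits_two_four {n : ℕ} (hn : 1 ≤ n) (hd : 2 * n + 1 ≤ d) (l : ℕ)
    (A C₁ C₀ : ℝ) (hax : ∀ a : ℕ, 2 ≤ a → srwT d n l (vecOfParts d [a]) ≤ A)
    (hC1 : ∀ r : ℕ, 2 ≤ r → r ≤ d → ∃ m j, m + j = l + 1 ∧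
      Real.sqrt (srwI d n (2 * m) 0) * Real.sqrt (srwW d n j (classVec d r 0)) ≤ C₁)
    (hC0 : ∀ r : ℕ, 2 ≤ r → r ≤ d → ∃ m j, m + j = l ∧
      Real.sqrt (srwI d n (2 * m) 0) * Real.sqrt (srwW d n j (classVec d r 0)) ≤ C₀)
    (x : Fin d → ℤ) (hx : 2 ≤ ∑ j, |x j|) : srwT d n l x ≤ max A (C₁ + 4 / d * C₀) := by
  have hI : SpInvariant (srwT d n l) := fun τ y => by
    unfold srwT
    simp_rw [DhatSym_spAct]
  exact le_max_of_axis_or_multi (srwT d n l) hI A _ (m₀ := 2) (by norm_num) hax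
    (fun y hy hy0 h2 _ => srwT_le_of_srwK_le_four hd l y
      (srwK_le_of_splits_on_cone_two hn hd hC1 y hy hy0 h2)
      (srwK_le_of_splits_on_cone_two hn hd hC0 y hy hy0 h2)) x (by exact_mod_cast hx)

/-- **`sup_{‖x‖₁ ≥ 2} T_{n,l}`, external axis family, rule `2/d`** (`n ≥ 1`, `d ≥ 2(n+1)+1`): splits `≤ C₁` for
`K_{n,l+1}` at `n` and `≤ C₀` for `K_{n+1,l}` at `n + 1` on the nodes `1^r` (`2 ≤ r ≤ d`) ⇒
`T_{n,l}(x) ≤ max A (C₁ + (2/d) C₀)` whenever `Σ_μ |x_μ| ≥ 2`.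
[cite: FitznerVanDerHofstad2016NoBLE, (5.11) p. 1092, (5.15)–(5.16) p. 1092, §5.1 p. 1093] -/
theorem srwT_le_of_axisBound_nodeSplits_two_two {n : ℕ} (hn : 1 ≤ n) (hd : 2 * (n + 1) + 1 ≤ d) (l : ℕ)
    (A C₁ C₀ : ℝ) (hax : ∀ a : ℕ, 2 ≤ a → srwT d n l (vecOfParts d [a]) ≤ A)
    (hC1 : ∀ r : ℕ, 2 ≤ r → r ≤ d → ∃ m j, m + j = l + 1 ∧
      Real.sqrt (srwI d n (2 * m) 0) * Real.sqrt (srwW d n j (classVec d r 0)) ≤ C₁)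
    (hC0 : ∀ r : ℕ, 2 ≤ r → r ≤ d → ∃ m j, m + j = l ∧
      Real.sqrt (srwI d (n + 1) (2 * m) 0) * Real.sqrt (srwW d (n + 1) j (classVec d r 0)) ≤ C₀)
    (x : Fin d → ℤ) (hx : 2 ≤ ∑ j, |x j|) : srwT d n l x ≤ max A (C₁ + 2 / d * C₀) := by
  have hI : SpInvariant (srwT d n l) := fun τ y => by
    unfold srwT
    simp_rw [DhatSym_spAct]
  exact le_max_of_axis_or_multi (srwT d n l) hI A _ (m₀ := 2) (by norm_num) hax
    (fun y hy hy0 h2 _ => srwT_le_of_srwK_le_two hd l y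
      (srwK_le_of_splits_on_cone_two hn (by omega) hC1 y hy hy0 h2)
      (srwK_le_of_splits_on_cone_two (by omega) hd hC0 y hy hy0 h2)) x (by exact_mod_cast hx)

/-- **`sup_{‖x‖₁ ≥ 3} T_{n,l}` with an external axis-family bound, rule `4/d`** (`n ≥ 1`, `d ≥ 2n+1`): axis
family `≤ A` (`a ≥ 3`); on the cone the pair `2e₁+e₂`, `2e₁+2e₂` and the nodes `1^r` (`3 ≤ r ≤ d`) carry splits
`≤ C₁` (`m + j = l + 1`) and `≤ C₀` (`m + j = l`) ⇒ `T_{n,l}(x) ≤ max A (C₁ + (4/d) C₀)` whenever `Σ_μ |x_μ| ≥ 3`.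
[cite: FitznerVanDerHofstad2016NoBLE, (5.11) p. 1092, (5.15)–(5.16) p. 1092, §5.1 p. 1093] -/
theorem srwT_le_of_axisBound_nodeSplits_three_four {n : ℕ} (hn : 1 ≤ n) (hd : 2 * n + 1 ≤ d) (l : ℕ)
    (A C₁ C₀ : ℝ) (hax : ∀ a : ℕ, 3 ≤ a → srwT d n l (vecOfParts d [a]) ≤ A)
    (h2x1 : ∃ m j, m + j = l + 1 ∧
      Real.sqrt (srwI d n (2 * m) 0) * Real.sqrt (srwW d n j (vecOfParts d [2, 1])) ≤ C₁ ∧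
      Real.sqrt (srwI d n (2 * m) 0) * Real.sqrt (srwW d n j (vecOfParts d [2, 2])) ≤ C₁)
    (hC1 : ∀ r : ℕ, 3 ≤ r → r ≤ d → ∃ m j, m + j = l + 1 ∧
      Real.sqrt (srwI d n (2 * m) 0) * Real.sqrt (srwW d n j (classVec d r 0)) ≤ C₁)
    (h2x0 : ∃ m j, m + j = l ∧
      Real.sqrt (srwI d n (2 * m) 0) * Real.sqrt (srwW d n j (vecOfParts d [2, 1])) ≤ C₀ ∧
      Real.sqrt (srwI d n (2 * m) 0) * Real.sqrt (srwW d n j (vecOfParts d [2, 2])) ≤ C₀)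
    (hC0 : ∀ r : ℕ, 3 ≤ r → r ≤ d → ∃ m j, m + j = l ∧
      Real.sqrt (srwI d n (2 * m) 0) * Real.sqrt (srwW d n j (classVec d r 0)) ≤ C₀)
    (x : Fin d → ℤ) (hx : 3 ≤ ∑ j, |x j|) : srwT d n l x ≤ max A (C₁ + 4 / d * C₀) := by
  have hI : SpInvariant (srwT d n l) := fun τ y => by
    unfold srwT
    simp_rw [DhatSym_spAct]
  exact le_max_of_axis_or_multi (srwT d n l) hI A _ (m₀ := 3) (by norm_num) hax
    (fun y hy hy0 h2 h3 => srwT_le_of_srwK_le_four hd l y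
      (srwK_le_of_splits_on_cone_three hn hd h2x1 hC1 y hy hy0 h2 (by exact_mod_cast h3))
      (srwK_le_of_splits_on_cone_three hn hd h2x0 hC0 y hy hy0 h2 (by exact_mod_cast h3)))
    x (by exact_mod_cast hx)

/-- **`sup_{‖x‖₁ ≥ 3} T_{n,l}`, external axis family, rule `2/d`** (`n ≥ 1`, `d ≥ 2(n+1)+1`): the `C₁` data for
`K_{n,l+1}` at `n`, the `C₀` data for `K_{n+1,l}` at `n + 1` ⇒ `T_{n,l}(x) ≤ max A (C₁ + (2/d) C₀)` whenever
`Σ_μ |x_μ| ≥ 3`. [cite: FitznerVanDerHofstad2016NoBLE, (5.11) p. 1092, (5.15)–(5.16) p. 1092, §5.1 p. 1093] -/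
theorem srwT_le_of_axisBound_nodeSplits_three_two {n : ℕ} (hn : 1 ≤ n) (hd : 2 * (n + 1) + 1 ≤ d) (l : ℕ)
    (A C₁ C₀ : ℝ) (hax : ∀ a : ℕ, 3 ≤ a → srwT d n l (vecOfParts d [a]) ≤ A)
    (h2x1 : ∃ m j, m + j = l + 1 ∧
      Real.sqrt (srwI d n (2 * m) 0) * Real.sqrt (srwW d n j (vecOfParts d [2, 1])) ≤ C₁ ∧
      Real.sqrt (srwI d n (2 * m) 0) * Real.sqrt (srwW d n j (vecOfParts d [2, 2])) ≤ C₁)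
    (hC1 : ∀ r : ℕ, 3 ≤ r → r ≤ d → ∃ m j, m + j = l + 1 ∧
      Real.sqrt (srwI d n (2 * m) 0) * Real.sqrt (srwW d n j (classVec d r 0)) ≤ C₁)
    (h2x0 : ∃ m j, m + j = l ∧
      Real.sqrt (srwI d (n + 1) (2 * m) 0) * Real.sqrt (srwW d (n + 1) j (vecOfParts d [2, 1])) ≤ C₀ ∧
      Real.sqrt (srwI d (n + 1) (2 * m) 0) * Real.sqrt (srwW d (n + 1) j (vecOfParts d [2, 2])) ≤ C₀)
    (hC0 : ∀ r : ℕ, 3 ≤ r → r ≤ d → ∃ m j, m + j = l ∧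
      Real.sqrt (srwI d (n + 1) (2 * m) 0) * Real.sqrt (srwW d (n + 1) j (classVec d r 0)) ≤ C₀)
    (x : Fin d → ℤ) (hx : 3 ≤ ∑ j, |x j|) : srwT d n l x ≤ max A (C₁ + 2 / d * C₀) := by
  have hI : SpInvariant (srwT d n l) := fun τ y => by
    unfold srwT
    simp_rw [DhatSym_spAct]
  exact le_max_of_axis_or_multi (srwT d n l) hI A _ (m₀ := 3) (by norm_num) hax
    (fun y hy hy0 h2 h3 => srwT_le_of_srwK_le_two hd l y
      (srwK_le_of_splits_on_cone_three hn (by omega) h2x1 hC1 y hy hy0 h2 (by exact_mod_cast h3))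
      (srwK_le_of_splits_on_cone_three (by omega) hd h2x0 hC0 y hy hy0 h2 (by exact_mod_cast h3)))
    x (by exact_mod_cast hx)

/-- **`sup_{‖x‖₁ ≥ 2} T_{n,l}`, axis family in cell shape, rule `4/d`** (`Pi.single i m`, `|m| ≥ 2`, any axis `i`).
[cite: FitznerVanDerHofstad2016NoBLE, (5.11) p. 1092, §5.1 p. 1093] -/
theorem srwT_le_of_axisFamily_nodeSplits_two_four {n : ℕ} (hn : 1 ≤ n) (hd : 2 * n + 1 ≤ d) (l : ℕ)
    (A C₁ C₀ : ℝ) (i : Fin d) (hax : ∀ m : ℤ, 2 ≤ m.natAbs → srwT d n l (Pi.single i m) ≤ A)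
    (hC1 : ∀ r : ℕ, 2 ≤ r → r ≤ d → ∃ m j, m + j = l + 1 ∧
      Real.sqrt (srwI d n (2 * m) 0) * Real.sqrt (srwW d n j (classVec d r 0)) ≤ C₁)
    (hC0 : ∀ r : ℕ, 2 ≤ r → r ≤ d → ∃ m j, m + j = l ∧
      Real.sqrt (srwI d n (2 * m) 0) * Real.sqrt (srwW d n j (classVec d r 0)) ≤ C₀)
    (x : Fin d → ℤ) (hx : 2 ≤ ∑ j, |x j|) : srwT d n l x ≤ max A (C₁ + 4 / d * C₀) :=
  srwT_le_of_axisBound_nodeSplits_two_four hn hd l A C₁ C₀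
    (axisBound_of_axisFamily (fun τ y => by unfold srwT; simp_rw [DhatSym_spAct]) (by omega) i hax)
    hC1 hC0 x hx

/-- **`sup_{‖x‖₁ ≥ 2} T_{n,l}`, axis family in cell shape, rule `2/d`** (`d ≥ 2(n+1)+1`).
[cite: FitznerVanDerHofstad2016NoBLE, (5.11) p. 1092, §5.1 p. 1093] -/
theorem srwT_le_of_axisFamily_nodeSplits_two_two {n : ℕ} (hn : 1 ≤ n) (hd : 2 * (n + 1) + 1 ≤ d) (l : ℕ)
    (A C₁ C₀ : ℝ) (i : Fin d) (hax : ∀ m : ℤ, 2 ≤ m.natAbs → srwT d n l (Pi.single i m) ≤ A)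
    (hC1 : ∀ r : ℕ, 2 ≤ r → r ≤ d → ∃ m j, m + j = l + 1 ∧
      Real.sqrt (srwI d n (2 * m) 0) * Real.sqrt (srwW d n j (classVec d r 0)) ≤ C₁)
    (hC0 : ∀ r : ℕ, 2 ≤ r → r ≤ d → ∃ m j, m + j = l ∧
      Real.sqrt (srwI d (n + 1) (2 * m) 0) * Real.sqrt (srwW d (n + 1) j (classVec d r 0)) ≤ C₀)
    (x : Fin d → ℤ) (hx : 2 ≤ ∑ j, |x j|) : srwT d n l x ≤ max A (C₁ + 2 / d * C₀) :=
  srwT_le_of_axisBound_nodeSplits_two_two hn hd l A C₁ C₀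
    (axisBound_of_axisFamily (fun τ y => by unfold srwT; simp_rw [DhatSym_spAct]) (by omega) i hax)
    hC1 hC0 x hx

/-- **`sup_{‖x‖₁ ≥ 3} T_{n,l}`, axis family in cell shape, rule `4/d`** (`Pi.single i m`, `|m| ≥ 3`, any axis `i`).
[cite: FitznerVanDerHofstad2016NoBLE, (5.11) p. 1092, §5.1 p. 1093] -/
theorem srwT_le_of_axisFamily_nodeSplits_three_four {n : ℕ} (hn : 1 ≤ n) (hd : 2 * n + 1 ≤ d) (l : ℕ)
    (A C₁ C₀ : ℝ) (i : Fin d) (hax : ∀ m : ℤ, 3 ≤ m.natAbs → srwT d n l (Pi.single i m) ≤ A)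
    (h2x1 : ∃ m j, m + j = l + 1 ∧
      Real.sqrt (srwI d n (2 * m) 0) * Real.sqrt (srwW d n j (vecOfParts d [2, 1])) ≤ C₁ ∧
      Real.sqrt (srwI d n (2 * m) 0) * Real.sqrt (srwW d n j (vecOfParts d [2, 2])) ≤ C₁)
    (hC1 : ∀ r : ℕ, 3 ≤ r → r ≤ d → ∃ m j, m + j = l + 1 ∧
      Real.sqrt (srwI d n (2 * m) 0) * Real.sqrt (srwW d n j (classVec d r 0)) ≤ C₁)
    (h2x0 : ∃ m j, m + j = l ∧
      Real.sqrt (srwI d n (2 * m) 0) * Real.sqrt (srwW d n j (vecOfParts d [2, 1])) ≤ C₀ ∧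
      Real.sqrt (srwI d n (2 * m) 0) * Real.sqrt (srwW d n j (vecOfParts d [2, 2])) ≤ C₀)
    (hC0 : ∀ r : ℕ, 3 ≤ r → r ≤ d → ∃ m j, m + j = l ∧
      Real.sqrt (srwI d n (2 * m) 0) * Real.sqrt (srwW d n j (classVec d r 0)) ≤ C₀)
    (x : Fin d → ℤ) (hx : 3 ≤ ∑ j, |x j|) : srwT d n l x ≤ max A (C₁ + 4 / d * C₀) :=
  srwT_le_of_axisBound_nodeSplits_three_four hn hd l A C₁ C₀
    (axisBound_of_axisFamily (fun τ y => by unfold srwT; simp_rw [DhatSym_spAct]) (by omega) i hax)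
    h2x1 hC1 h2x0 hC0 x hx

/-- **`sup_{‖x‖₁ ≥ 3} T_{n,l}`, axis family in cell shape, rule `2/d`** (`d ≥ 2(n+1)+1`).
[cite: FitznerVanDerHofstad2016NoBLE, (5.11) p. 1092, §5.1 p. 1093] -/
theorem srwT_le_of_axisFamily_nodeSplits_three_two {n : ℕ} (hn : 1 ≤ n) (hd : 2 * (n + 1) + 1 ≤ d) (l : ℕ)
    (A C₁ C₀ : ℝ) (i : Fin d) (hax : ∀ m : ℤ, 3 ≤ m.natAbs → srwT d n l (Pi.single i m) ≤ A)
    (h2x1 : ∃ m j, m + j = l + 1 ∧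
      Real.sqrt (srwI d n (2 * m) 0) * Real.sqrt (srwW d n j (vecOfParts d [2, 1])) ≤ C₁ ∧
      Real.sqrt (srwI d n (2 * m) 0) * Real.sqrt (srwW d n j (vecOfParts d [2, 2])) ≤ C₁)
    (hC1 : ∀ r : ℕ, 3 ≤ r → r ≤ d → ∃ m j, m + j = l + 1 ∧
      Real.sqrt (srwI d n (2 * m) 0) * Real.sqrt (srwW d n j (classVec d r 0)) ≤ C₁)
    (h2x0 : ∃ m j, m + j = l ∧
      Real.sqrt (srwI d (n + 1) (2 * m) 0) * Real.sqrt (srwW d (n + 1) j (vecOfParts d [2, 1])) ≤ C₀ ∧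
      Real.sqrt (srwI d (n + 1) (2 * m) 0) * Real.sqrt (srwW d (n + 1) j (vecOfParts d [2, 2])) ≤ C₀)
    (hC0 : ∀ r : ℕ, 3 ≤ r → r ≤ d → ∃ m j, m + j = l ∧
      Real.sqrt (srwI d (n + 1) (2 * m) 0) * Real.sqrt (srwW d (n + 1) j (classVec d r 0)) ≤ C₀)
    (x : Fin d → ℤ) (hx : 3 ≤ ∑ j, |x j|) : srwT d n l x ≤ max A (C₁ + 2 / d * C₀) :=
  srwT_le_of_axisBound_nodeSplits_three_two hn hd l A C₁ C₀
    (axisBound_of_axisFamily (fun τ y => by unfold srwT; simp_rw [DhatSym_spAct]) (by omega) i hax)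
    h2x1 hC1 h2x0 hC0 x hx

/-! ### §7  Closing the real-valued slots from ℚ table bounds

The cone hypotheses `hC`, `h2x`, the Cauchy–Schwarz tails and the `U` conclusion `√V' · √B` are real square-root
expressions; a table assembler holds upper bounds of the plain seeds as ℚ literals.  The lemmas below discharge the slots
from such bounds and ℚ side conditions `0 ≤ C`, `iU · wU ≤ C²` (decidable by `norm_num` / `decide`). -/

/-- [folklore] `√I · √W ≤ q` from `I ≤ iU`, `0 ≤ W ≤ wU`, `0 ≤ q`, `iU · wU ≤ q²` (ℚ data, cast to `ℝ`). -/
private theorem sqrt_mul_sqrt_le_ratCast {I W : ℝ} {iU wU q : ℚ} (hW0 : 0 ≤ W) (hI : I ≤ iU) (hW : W ≤ wU)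
    (hq : 0 ≤ q) (h : iU * wU ≤ q ^ 2) : Real.sqrt I * Real.sqrt W ≤ (q : ℝ) := by
  have hwU : (0 : ℝ) ≤ wU := hW0.trans hW
  calc Real.sqrt I * Real.sqrt W ≤ Real.sqrt iU * Real.sqrt wU :=
        mul_le_mul (Real.sqrt_le_sqrt hI) (Real.sqrt_le_sqrt hW) (Real.sqrt_nonneg _) (Real.sqrt_nonneg _)
    _ = Real.sqrt ((iU : ℝ) * wU) := (Real.sqrt_mul' _ hwU).symm
    _ ≤ Real.sqrt ((q : ℝ) ^ 2) := Real.sqrt_le_sqrt (by exact_mod_cast h)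
    _ = (q : ℝ) := Real.sqrt_sq (by exact_mod_cast hq)

/-- [folklore] `√V' · √B ≤ q` for ℚ literals with `0 ≤ q`, `V'·B ≤ q²` (either sign of `B`). -/
private theorem sqrt_ratCast_mul_sqrt_ratCast_le {V B q : ℚ} (hq : 0 ≤ q) (h : V * B ≤ q ^ 2) :
    Real.sqrt (V : ℝ) * Real.sqrt (B : ℝ) ≤ (q : ℝ) := by
  rcases le_or_gt 0 B with hB0 | hB0
  · exact sqrt_mul_sqrt_le_ratCast (W := (B : ℝ)) (by exact_mod_cast hB0) le_rfl le_rfl hq h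
  · rw [Real.sqrt_eq_zero'.mpr (show ((B : ℚ) : ℝ) ≤ 0 by exact_mod_cast hB0.le), mul_zero]
    exact_mod_cast hq

/-- **One cone split from seed bounds**: `I_{n,2m}(0) ≤ iU`, `W_{n,j}(y) ≤ wU`, `0 ≤ C`, `iU·wU ≤ C²` give the `∃`-shaped
split hypothesis `∃ m' j', m' + j' = l ∧ √I_{n,2m'}(0) √W_{n,j'}(y) ≤ C` (`m + j = l`) of the `K`/`T` sup lemmas.
[cite: FitznerVanDerHofstad2016NoBLE, (5.15)–(5.16) p. 1092] -/
theorem exists_split_of_seedBounds_cast {n l : ℕ} (m j : ℕ) (hl : m + j = l) (y : Fin d → ℤ) {iU wU C : ℚ}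
    (hI : srwI d n (2 * m) 0 ≤ iU) (hW : srwW d n j y ≤ wU) (hC : 0 ≤ C) (h : iU * wU ≤ C ^ 2) :
    ∃ m' j', m' + j' = l ∧
      Real.sqrt (srwI d n (2 * m') 0) * Real.sqrt (srwW d n j' y) ≤ ((C : ℚ) : ℝ) :=
  ⟨m, j, hl, sqrt_mul_sqrt_le_ratCast (srwW_nonneg n j y) hI hW hC h⟩

/-- **The `1^r` cone family from one uniform seed bound**: `I_{n,2m}(0) ≤ iU` and `W_{n,j}(1^r) ≤ wU` for `m₀ ≤ r ≤ d`
(e.g. from sorted antitonicity at `1^{m₀}`), `0 ≤ C`, `iU·wU ≤ C²` give the `hC` hypothesis of the sup lemmas.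
[cite: FitznerVanDerHofstad2016NoBLE, (5.15)–(5.16) p. 1092, §5.1 p. 1093] -/
theorem forall_split_of_seedBounds_cast {n l m₀ : ℕ} (m j : ℕ) (hl : m + j = l) {iU wU C : ℚ}
    (hI : srwI d n (2 * m) 0 ≤ iU) (hW : ∀ r : ℕ, m₀ ≤ r → r ≤ d → srwW d n j (classVec d r 0) ≤ wU)
    (hC : 0 ≤ C) (h : iU * wU ≤ C ^ 2) :
    ∀ r : ℕ, m₀ ≤ r → r ≤ d → ∃ m' j', m' + j' = l ∧
      Real.sqrt (srwI d n (2 * m') 0) * Real.sqrt (srwW d n j' (classVec d r 0)) ≤ ((C : ℚ) : ℝ) :=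
  fun r hr hrd => exists_split_of_seedBounds_cast m j hl _ hI (hW r hr hrd) hC h

/-- **The pair `2e₁+e₂`, `2e₁+2e₂` from seed bounds** (the `h2x` hypothesis of the `‖x‖₁ ≥ 3` sup lemmas).
[cite: FitznerVanDerHofstad2016NoBLE, (5.15)–(5.16) p. 1092, §5.1 p. 1093] -/
theorem exists_pairSplit_of_seedBounds_cast {n l : ℕ} (m j : ℕ) (hl : m + j = l) {iU w₂₁ w₂₂ C : ℚ}
    (hI : srwI d n (2 * m) 0 ≤ iU) (h21 : srwW d n j (vecOfParts d [2, 1]) ≤ w₂₁)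
    (h22 : srwW d n j (vecOfParts d [2, 2]) ≤ w₂₂) (hC : 0 ≤ C) (h1 : iU * w₂₁ ≤ C ^ 2)
    (h2 : iU * w₂₂ ≤ C ^ 2) :
    ∃ m' j', m' + j' = l ∧
      Real.sqrt (srwI d n (2 * m') 0) * Real.sqrt (srwW d n j' (vecOfParts d [2, 1])) ≤ ((C : ℚ) : ℝ) ∧
      Real.sqrt (srwI d n (2 * m') 0) * Real.sqrt (srwW d n j' (vecOfParts d [2, 2])) ≤ ((C : ℚ) : ℝ) :=
  ⟨m, j, hl, sqrt_mul_sqrt_le_ratCast (srwW_nonneg n j _) hI h21 hC h1,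
    sqrt_mul_sqrt_le_ratCast (srwW_nonneg n j _) hI h22 hC h2⟩

/-- **`K` tail from seed bounds**: `I_{n,2m}(0) ≤ iU`, `W_{n,j}(M e₀) ≤ wU`, `0 ≤ q`, `iU·wU ≤ q²` give
`K_{n,l}(m' e_i) ≤ q` for every `|m'| ≥ M` (`m + j = l`, `n ≥ 1`, `d ≥ 2n+1`).
[cite: FitznerVanDerHofstad2016NoBLE, (5.15)–(5.16) p. 1092, §5.1 p. 1093] -/
theorem srwK_axisFamily_of_seedBounds_cast {n : ℕ} (hn : 1 ≤ n) (hd : 2 * n + 1 ≤ d) (i : Fin d) (M : ℕ)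
    {l : ℕ} (m j : ℕ) (hl : m + j = l) {iU wU q : ℚ} (hI : srwI d n (2 * m) 0 ≤ iU)
    (hW : srwW d n j (vecOfParts d [M]) ≤ wU) (hq : 0 ≤ q) (h : iU * wU ≤ q ^ 2) :
    ∀ m' : ℤ, M ≤ m'.natAbs → srwK d n l (Pi.single i m') ≤ ((q : ℚ) : ℝ) := by
  subst hl
  exact srwK_axisFamily_of_split hn hd i M (sqrt_mul_sqrt_le_ratCast (srwW_nonneg n j _) hI hW hq h)

/-- **`U` tail from seed bounds**: `V_{n,2l} ≤ V'`, `L_n(M e₀) ≤ B`, `0 ≤ q`, `V'·B ≤ q²` (ℚ literals) give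
`U_{n,l}(m e_i) ≤ q` for every `|m| ≥ M` (`n ≥ 1`, `d ≥ 2n+1`).
[cite: FitznerVanDerHofstad2016NoBLE, (5.9) p. 1091, §5.1 p. 1093] -/
theorem srwU_axisFamily_of_seedBounds_cast {n : ℕ} (hn : 1 ≤ n) (hd : 2 * n + 1 ≤ d) (l : ℕ) (i : Fin d)
    (M : ℕ) {V' B q : ℚ} (hV : srwV d n (2 * l) ≤ V') (hL : srwL d n (vecOfParts d [M]) ≤ B) (hq : 0 ≤ q)
    (h : V' * B ≤ q ^ 2) : ∀ m : ℤ, M ≤ m.natAbs → srwU d n l (Pi.single i m) ≤ ((q : ℚ) : ℝ) :=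
  fun m hm => (srwU_axisFamily_of_split hn hd l i M hV hL m hm).trans (sqrt_ratCast_mul_sqrt_ratCast_le hq h)

/-- **`T` tail from seed bounds, rule `4/d`** (`n ≥ 1`, `d ≥ 2n+1`): the two `K` tails at `M e₀` for `K_{n,l+1}`
(`m₁ + j₁ = l + 1`) and `K_{n,l}` (`m₀ + j₀ = l`) from ℚ seed bounds, composed with (5.11):
`T_{n,l}(m' e_i) ≤ q₁ + (4/d) q₀` for every `|m'| ≥ M`, the right-hand side as ONE ℚ literal.
[cite: FitznerVanDerHofstad2016NoBLE, (5.11) p. 1092, (5.15)–(5.16) p. 1092, §5.1 p. 1093] -/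
theorem srwT_axisFamily_of_seedBounds_cast_four {n : ℕ} (hn : 1 ≤ n) (hd : 2 * n + 1 ≤ d) (i : Fin d)
    (M l : ℕ) (m₁ j₁ : ℕ) (hl1 : m₁ + j₁ = l + 1) (m₀ j₀ : ℕ) (hl0 : m₀ + j₀ = l)
    {i₁ w₁ q₁ i₀ w₀ q₀ : ℚ} (hI1 : srwI d n (2 * m₁) 0 ≤ i₁) (hW1 : srwW d n j₁ (vecOfParts d [M]) ≤ w₁)
    (hq1 : 0 ≤ q₁) (h1 : i₁ * w₁ ≤ q₁ ^ 2) (hI0 : srwI d n (2 * m₀) 0 ≤ i₀)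
    (hW0 : srwW d n j₀ (vecOfParts d [M]) ≤ w₀) (hq0 : 0 ≤ q₀) (h0 : i₀ * w₀ ≤ q₀ ^ 2) :
    ∀ m' : ℤ, M ≤ m'.natAbs → srwT d n l (Pi.single i m') ≤ ((q₁ + 4 / d * q₀ : ℚ) : ℝ) := by
  intro m' hm
  refine (srwT_le_of_srwK_le_four hd l (Pi.single i m')
    (srwK_axisFamily_of_seedBounds_cast hn hd i M m₁ j₁ hl1 hI1 hW1 hq1 h1 m' hm)
    (srwK_axisFamily_of_seedBounds_cast hn hd i M m₀ j₀ hl0 hI0 hW0 hq0 h0 m' hm)).trans (le_of_eq ?_)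
  push_cast
  ring

/-- **`T` tail from seed bounds, rule `2/d`** (`n ≥ 1`, `d ≥ 2(n+1)+1`): the `K_{n,l+1}` tail at `n` and the
`K_{n+1,l}` tail at `n + 1` from ℚ seed bounds give `T_{n,l}(m' e_i) ≤ q₁ + (2/d) q₀` for every `|m'| ≥ M`.
[cite: FitznerVanDerHofstad2016NoBLE, (5.11) p. 1092, (5.15)–(5.16) p. 1092, §5.1 p. 1093] -/
theorem srwT_axisFamily_of_seedBounds_cast_two {n : ℕ} (hn : 1 ≤ n) (hd : 2 * (n + 1) + 1 ≤ d) (i : Fin d)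
    (M l : ℕ) (m₁ j₁ : ℕ) (hl1 : m₁ + j₁ = l + 1) (m₀ j₀ : ℕ) (hl0 : m₀ + j₀ = l)
    {i₁ w₁ q₁ i₀ w₀ q₀ : ℚ} (hI1 : srwI d n (2 * m₁) 0 ≤ i₁) (hW1 : srwW d n j₁ (vecOfParts d [M]) ≤ w₁)
    (hq1 : 0 ≤ q₁) (h1 : i₁ * w₁ ≤ q₁ ^ 2) (hI0 : srwI d (n + 1) (2 * m₀) 0 ≤ i₀)
    (hW0 : srwW d (n + 1) j₀ (vecOfParts d [M]) ≤ w₀) (hq0 : 0 ≤ q₀) (h0 : i₀ * w₀ ≤ q₀ ^ 2) :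
    ∀ m' : ℤ, M ≤ m'.natAbs → srwT d n l (Pi.single i m') ≤ ((q₁ + 2 / d * q₀ : ℚ) : ℝ) := by
  intro m' hm
  refine (srwT_le_of_srwK_le_two hd l (Pi.single i m')
    (srwK_axisFamily_of_seedBounds_cast hn (by omega) i M m₁ j₁ hl1 hI1 hW1 hq1 h1 m' hm)
    (srwK_axisFamily_of_seedBounds_cast (by omega) hd i M m₀ j₀ hl0 hI0 hW0 hq0 h0 m' hm)).trans (le_of_eq ?_)
  push_cast
  ring

/-- **`sup_{x ≠ 0} U_{n,l}`, fully ℚ-closed**: axis family `≤ A` (cells, `|m| ≥ 1`), `V_{n,2l} ≤ V'`, `L_n(1^r) ≤ B`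
(`2 ≤ r ≤ d`), `0 ≤ q`, `V'·B ≤ q²` ⇒ `U_{n,l}(x) ≤ max A q` for every `x ≠ 0`.
[cite: FitznerVanDerHofstad2016NoBLE, (5.9) p. 1091, §5.1 p. 1093] -/
theorem srwU_le_of_axisFamily_nodeBounds_one_cast {n : ℕ} (hn : 1 ≤ n) (hd : 2 * n + 1 ≤ d) (l : ℕ)
    (i : Fin d) {A V' B q : ℚ} (hax : ∀ m : ℤ, 1 ≤ m.natAbs → srwU d n l (Pi.single i m) ≤ (A : ℝ))
    (hV : srwV d n (2 * l) ≤ V') (hB : ∀ r : ℕ, 2 ≤ r → r ≤ d → srwL d n (classVec d r 0) ≤ B)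
    (hq : 0 ≤ q) (h : V' * B ≤ q ^ 2) (x : Fin d → ℤ) (hx : x ≠ 0) :
    srwU d n l x ≤ max ((A : ℚ) : ℝ) ((q : ℚ) : ℝ) :=
  (srwU_le_of_axisFamily_nodeBounds_one hn hd l (A : ℝ) i hax hV hB x hx).trans
    (max_le_max le_rfl (sqrt_ratCast_mul_sqrt_ratCast_le hq h))

/-- **`sup_{‖x‖₁ ≥ 2} U_{n,l}`, fully ℚ-closed**: axis family `≤ A` (`|m| ≥ 2`), `V_{n,2l} ≤ V'`, `L_n(1^r) ≤ B`
(`2 ≤ r ≤ d`), `0 ≤ q`, `V'·B ≤ q²` ⇒ `U_{n,l}(x) ≤ max A q` whenever `Σ_μ |x_μ| ≥ 2`.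
[cite: FitznerVanDerHofstad2016NoBLE, (5.9) p. 1091, §5.2 p. 1096] -/
theorem srwU_le_of_axisFamily_nodeBounds_two_cast {n : ℕ} (hn : 1 ≤ n) (hd : 2 * n + 1 ≤ d) (l : ℕ)
    (i : Fin d) {A V' B q : ℚ} (hax : ∀ m : ℤ, 2 ≤ m.natAbs → srwU d n l (Pi.single i m) ≤ (A : ℝ))
    (hV : srwV d n (2 * l) ≤ V') (hB : ∀ r : ℕ, 2 ≤ r → r ≤ d → srwL d n (classVec d r 0) ≤ B)
    (hq : 0 ≤ q) (h : V' * B ≤ q ^ 2) (x : Fin d → ℤ) (hx : 2 ≤ ∑ j, |x j|) :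
    srwU d n l x ≤ max ((A : ℚ) : ℝ) ((q : ℚ) : ℝ) :=
  (srwU_le_of_axisFamily_nodeBounds_two hn hd l (A : ℝ) i hax hV hB x hx).trans
    (max_le_max le_rfl (sqrt_ratCast_mul_sqrt_ratCast_le hq h))

/-- **`sup_{‖x‖₁ ≥ 3} U_{n,l}`, fully ℚ-closed**: axis family `≤ A` (`|m| ≥ 3`), `V_{n,2l} ≤ V'`, the pair
`L_n(2e₁+e₂), L_n(2e₁+2e₂) ≤ B`, `L_n(1^r) ≤ B` (`3 ≤ r ≤ d`), `0 ≤ q`, `V'·B ≤ q²` ⇒ `U_{n,l}(x) ≤ max A q`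
whenever `Σ_μ |x_μ| ≥ 3`. [cite: FitznerVanDerHofstad2016NoBLE, (5.9) p. 1091, §5.1 p. 1093] -/
theorem srwU_le_of_axisFamily_nodeBounds_three_cast {n : ℕ} (hn : 1 ≤ n) (hd : 2 * n + 1 ≤ d) (l : ℕ)
    (i : Fin d) {A V' B q : ℚ} (hax : ∀ m : ℤ, 3 ≤ m.natAbs → srwU d n l (Pi.single i m) ≤ (A : ℝ))
    (hV : srwV d n (2 * l) ≤ V') (h21 : srwL d n (vecOfParts d [2, 1]) ≤ B)
    (h22 : srwL d n (vecOfParts d [2, 2]) ≤ B)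
    (hB : ∀ r : ℕ, 3 ≤ r → r ≤ d → srwL d n (classVec d r 0) ≤ B) (hq : 0 ≤ q) (h : V' * B ≤ q ^ 2)
    (x : Fin d → ℤ) (hx : 3 ≤ ∑ j, |x j|) :
    srwU d n l x ≤ max ((A : ℚ) : ℝ) ((q : ℚ) : ℝ) :=
  (srwU_le_of_axisFamily_nodeBounds_three hn hd l (A : ℝ) i hax hV h21 h22 hB x hx).trans
    (max_le_max le_rfl (sqrt_ratCast_mul_sqrt_ratCast_le hq h))

end Literature.Probability.FitznerVanDerHofstad2017
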